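import Summits.AtomisticToContinuum.HydrodynamicLimit.Theorems.AntiMazurCoboundariesCorrectorPressureDecayKiferSetwiseUpgrade
import Mathlib.InformationTheory.KullbackLeibler.Basic

/-!
# Window lower semicontinuity of the relative entropy against a fixed reference along tangent states (line `FirstLemma`, crux stmt-AtomisticToContinuum-14135)

Registered stub `c9_klDiv_windowLaw_tangent_le_liminf` of line `FirstLemma` (skeleton v12, idea
`kifer-compactification`), namespace `Summit.AtomisticToContinuum.HydrodynamicLimit.Theorems.KiferCompactification` —
the window step of the Gibbs route of the entropy bound for unit-weight tangent states: for a unit-weight tangent state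
`μ` of the laws `Q k` along `ι` (`IsTangentState σ 1 N Q ι μ`: the Laplace functionals of the blown-up laws
`P_k = blowUpLaw σ 1 (N (ι k)) (Q (ι k))` converge to those of `μ` on `C_c⁺(ℝ³ × ℝ³)`, by
`stub_laplaceFunctional_blowUpLaw`), an OPEN window `U ⊆ ℝ³` and a FIXED probability reference `ρ` on configurations,
`KL(μ_U ‖ ρ) ≤ liminf_k KL((P_k)_U ‖ ρ)` (`μ_U = windowLaw U μ`).

Proof (`klDiv_windowLaw_const_le_liminf_of_laplace`, for any Laplace-convergent sequence of probability laws). By the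
abstract lower semicontinuity of the Kullback–Leibler divergence along a dense test class
(`stub_klDiv_lsc_of_denseClass`, `…KiferEntropyLsc.lean`) with the CONSTANT reference `ρ` (so its exponential-moment
hypothesis is `tendsto_const_nhds`) and the test class `𝓥` of all functions `ψ'` along which
`∫ ψ' d(P_k)_U → ∫ ψ' dμ_U`, it suffices to approximate every measurable `ψ` with `|ψ| ≤ C` in `L¹(μ_U)` AND `L¹(ρ)` by
a member of `𝓥` with the same bound. With `π = windowRestrict U` (so `μ_U = π_* μ`, `π ∘ π = π`), the function
`ψ ∘ π` is measurable for the σ-algebra generated by the exponential statistics `e^{-S_f}`, `f ∈ C_c⁺` supported inside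
the open set `U × ℝ³` (`measurable_restrict_iSup_comap`, `…KiferSetwiseUpgradeSigma.lean`), hence
(`stub_cylinderDenseL1`, `…KiferEntropyLscDensity.lean`) `ε`-close in `L¹(μ + ρ)` to a bounded continuous cylinder
function `G` of finitely many such statistics, `|G| ≤ C`, `G ∘ π = G`; and `∫ G dP_k → ∫ G dμ`
(`tendsto_integral_bcf_expNegSumFn`, `…KiferSetwiseUpgradeLaplace.lean`). The approximant is
`ψ' = clamp_{[-C, C]} (G + ψ - ψ ∘ π)`: on the range of `π` it equals `G`, so `∫ ψ' d(P_k)_U = ∫ G dP_k → ∫ G dμ =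
∫ ψ' dμ_U` and `‖ψ - ψ'‖_{L¹(μ_U)} = ‖ψ ∘ π - G‖_{L¹(μ)} ≤ ε`, while everywhere `|ψ - ψ'| ≤ |ψ ∘ π - G|` (clamping
towards `ψ ∈ [-C, C]`), so `‖ψ - ψ'‖_{L¹(ρ)} ≤ ‖ψ ∘ π - G‖_{L¹(ρ)} ≤ ε`. No domination and no boundedness of the
window are needed on this route. No new definitions.

References: M. D. Donsker, S. R. S. Varadhan, Comm. Pure Appl. Math. 28 (1975); P. Dupuis, R. S. Ellis, *A Weak
Convergence Approach to the Theory of Large Deviations* (1997), Lemma 1.4.3; O. Kallenberg, *Foundations of Modern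
Probability*, 2nd ed. (2002), Lemma 12.1, Thm. 16.16.
-/

noncomputable section

open MeasureTheory Set Filter Topology Function InformationTheory
open scoped ENNReal NNReal BoundedContinuousFunction

namespace Summit.AtomisticToContinuum.HydrodynamicLimit.Theorems.KiferCompactification

open Literature.MathematicalPhysics.KineticTheory (T3 V3 hsDiameter blowUp)
open Literature.MathematicalPhysics.KineticTheory.PointProcess (laplaceFunctional windowLaw windowRestrict
  measurable_windowRestrict isProbabilityMeasure_windowLaw measurable_exp_neg_finsum)
open Literature.Analysis.FluidPDE (Config hardSphereDomain)
open Literature.Analysis.FunctionSpaces (PointConfig)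

/-! ## Clamping -/

/-- Clamping to an interval containing `t` does not increase the distance to `t`. -/
private theorem abs_sub_clamp_le' {a b t x : ℝ} (hat : a ≤ t) (htb : t ≤ b) :
    |t - max a (min b x)| ≤ |t - x| := by
  rcases le_total x a with hxa | hxa
  · have h : max a (min b x) = a := max_eq_left ((min_le_right _ _).trans hxa)
    rw [h, abs_of_nonneg (sub_nonneg.2 hat), abs_of_nonneg (by linarith)]
    linarith
  rcases le_total b x with hbx | hbx
  · have h : max a (min b x) = b := by rw [min_eq_left hbx, max_eq_right (hat.trans htb)]
    rw [h, abs_of_nonpos (sub_nonpos.2 htb), abs_of_nonpos (by linarith)]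
    linarith
  · have h : max a (min b x) = x := by rw [min_eq_right hbx, max_eq_right hxa]
    rw [h]

/-! ## Window lower semicontinuity against a fixed reference from Laplace convergence -/

/-- **Window lower semicontinuity of `KL(· ‖ ρ)` along Laplace-convergent laws, fixed reference.** If the Laplace
functionals of probability laws `P k` on the configurations of `ℝ³ × ℝ³` converge to those of a probability law `μ` on
all of `C_c⁺`, then for every OPEN window `U` and every probability law `ρ`,
`KL(windowLaw U μ ‖ ρ) ≤ liminf_k KL(windowLaw U (P k) ‖ ρ)`. (Donsker–Varadhan along the dense test class of
`stub_klDiv_lsc_of_denseClass`: a bounded measurable `ψ` is approximated in `L¹(windowLaw U μ) ∩ L¹(ρ)` by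
`clamp_{[-C,C]} (G + ψ - ψ ∘ windowRestrict U)`, `G` a bounded continuous cylinder function of the exponential
statistics supported inside `U × ℝ³` that is `L¹(μ + ρ)`-close to `ψ ∘ windowRestrict U` —
`measurable_restrict_iSup_comap` and `stub_cylinderDenseL1` — whose integrals converge by
`tendsto_integral_bcf_expNegSumFn`.) -/
theorem klDiv_windowLaw_const_le_liminf_of_laplace {P : ℕ → Measure (PointConfig (V3 × V3))}
    {μ : Measure (PointConfig (V3 × V3))} [∀ k, IsProbabilityMeasure (P k)] [IsProbabilityMeasure μ]
    (hL : ∀ f : V3 × V3 → ℝ, Continuous f → HasCompactSupport f → (∀ x, 0 ≤ f x) →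
      Tendsto (fun k => laplaceFunctional (P k) f) atTop (𝓝 (laplaceFunctional μ f)))
    {U : Set V3} (hU : IsOpen U) (ρ : Measure (PointConfig (V3 × V3))) [IsProbabilityMeasure ρ] :
    klDiv (windowLaw U μ) ρ ≤ liminf (fun k => klDiv (windowLaw U (P k)) ρ) atTop := by
  have hUm : MeasurableSet U := hU.measurableSet
  haveI hPU : ∀ k, IsProbabilityMeasure (windowLaw U (P k)) := fun k => isProbabilityMeasure_windowLaw hUm _
  haveI hμU : IsProbabilityMeasure (windowLaw U μ) := isProbabilityMeasure_windowLaw hUm _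
  -- the open phase-space region `V = U × ℝ³`; the window restriction `π = windowRestrict U` is idempotent
  set V : Set (V3 × V3) := Prod.fst ⁻¹' U
  have hVo : IsOpen V := hU.preimage continuous_fst
  have hπm : Measurable (windowRestrict (M := V3) U) := measurable_windowRestrict hUm
  have hππ : ∀ ω : PointConfig (V3 × V3), windowRestrict U (windowRestrict U ω) = windowRestrict U ω :=
    fun ω => windowRestrict_windowRestrict subset_rfl ω
  -- integrals under window laws are integrals of the composition with `π`
  have hwl : ∀ (ρ' : Measure (PointConfig (V3 × V3))) {φ : PointConfig (V3 × V3) → ℝ}, Measurable φ →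
      ∫ x, φ x ∂(windowLaw U ρ') = ∫ x, φ (windowRestrict U x) ∂ρ' := fun ρ' φ hφ => by
    rw [windowLaw, integral_map hπm.aemeasurable hφ.aestronglyMeasurable]
  -- bounded measurable functions are integrable under finite laws
  have hbi : ∀ (ρ' : Measure (PointConfig (V3 × V3))) [IsFiniteMeasure ρ'] {φ : PointConfig (V3 × V3) → ℝ} {C : ℝ},
      Measurable φ → (∀ x, |φ x| ≤ C) → Integrable φ ρ' := fun ρ' _ φ C hφ hφC =>
    Integrable.of_bound hφ.aestronglyMeasurable C (ae_of_all _ fun x => by rw [Real.norm_eq_abs]; exact hφC x)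
  -- the abstract lower semicontinuity along the class of test functions whose window integrals converge; the
  -- reference is constant, so its exponential moments trivially converge
  refine stub_klDiv_lsc_of_denseClass (P := fun k => windowLaw U (P k)) (R := fun _ => ρ)
    {ψ | Tendsto (fun k => ∫ x, ψ x ∂(windowLaw U (P k))) atTop (𝓝 (∫ x, ψ x ∂(windowLaw U μ)))}
    (fun ψ hψ _ _ _ => hψ) (fun _ _ _ _ _ => tendsto_const_nhds) fun ψ C hψm hC ε hε => ?_
  -- DENSITY. The exponential statistics supported inside `V` and the σ-algebra they generate
  set T : {f : V3 × V3 → ℝ // Continuous f ∧ HasCompactSupport f ∧ (∀ x, 0 ≤ f x) ∧ tsupport f ⊆ V} →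
      PointConfig (V3 × V3) → ℝ := fun f ω => Real.exp (-(ω.sumFn f.1))
  have hTm : ∀ f, Measurable (T f) := fun f => measurable_exp_neg_finsum f.2.1.measurable f.2.2.1 f.2.2.2.1
  -- `ψ ∘ π` only sees the configuration in the open set `V`, hence is measurable for that σ-algebra
  have hψπ : Measurable[⨆ f, MeasurableSpace.comap (T f) inferInstance] fun ω => ψ (windowRestrict U ω) :=
    hψm.comp (measurable_restrict_iSup_comap hVo)
  have hCπ : ∀ ω, |ψ (windowRestrict U ω)| ≤ C := fun ω => hC _
  have hC0 : 0 ≤ C := (abs_nonneg _).trans (hC ∅)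
  -- functional monotone class theorem in `L¹(μ + ρ)`: a continuous cylinder function of finitely many statistics
  obtain ⟨s, g, hg, hg1, hgε⟩ := stub_cylinderDenseL1 T hTm (μ + ρ) hψπ hCπ hε
  -- clamp `g` to `[-C, C]` (no change on the relevant range) to get a bounded continuous function
  set gb : (↥s → ℝ) →ᵇ ℝ := BoundedContinuousFunction.mkOfBound
    ⟨fun v => max (-C) (min C (g v)), continuous_const.max (continuous_const.min hg)⟩ (2 * C) (fun v w => by
      rw [Real.dist_eq, abs_le]
      simp only [ContinuousMap.coe_mk]
      constructor <;>
        nlinarith [le_max_left (-C) (min C (g v)), max_le (show -C ≤ C by linarith) (min_le_left C (g v)),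
          le_max_left (-C) (min C (g w)), max_le (show -C ≤ C by linarith) (min_le_left C (g w))])
  have hgb_eq : ∀ ω, gb (fun i : ↥s => T i ω) = g (fun i : ↥s => T i ω) := by
    intro ω
    have h := abs_le.1 (hg1 ω)
    show max (-C) (min C (g fun i : ↥s => T i ω)) = g fun i : ↥s => T i ω
    rw [min_eq_right h.2, max_eq_right h.1]
  -- the cylinder function `G`
  obtain ⟨G, hGdef⟩ : ∃ G : PointConfig (V3 × V3) → ℝ, ∀ ω, G ω = gb (fun i : ↥s => T i ω) := ⟨_, fun _ => rfl⟩
  have hGfun : G = fun ω => gb (fun i : ↥s => T i ω) := funext hGdef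
  have hGm : Measurable G := by
    rw [hGfun]
    exact gb.continuous.measurable.comp (measurable_pi_lambda _ fun i => hTm i)
  have hGC : ∀ ω, |G ω| ≤ C := fun ω => by rw [hGdef, hgb_eq]; exact hg1 ω
  -- locality: the statistics supported inside `V = U × ℝ³` do not see points outside the window
  have hGπ : ∀ ω, G (windowRestrict U ω) = G ω := fun ω => by
    rw [hGdef, hGdef]
    refine congr_arg gb (funext fun i => ?_)
    show Real.exp (-((ω.restrict V).sumFn i.1.1)) = Real.exp (-(ω.sumFn i.1.1))
    rw [sumFn_restrict_of_tsupport_subset ω i.1.2.2.2.2]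
  -- convergence of the integrals of `G` (Stone–Weierstrass on Laplace functionals)
  have hGt : Tendsto (fun k => ∫ x, G x ∂(P k)) atTop (𝓝 (∫ x, G x ∂μ)) := by
    rw [hGfun]
    exact tendsto_integral_bcf_expNegSumFn hL (f := fun i : ↥s => (i : {f : V3 × V3 → ℝ // Continuous f ∧
      HasCompactSupport f ∧ (∀ x, 0 ≤ f x) ∧ tsupport f ⊆ V}).1) (fun i => i.1.2.1) (fun i => i.1.2.2.1)
      (fun i => i.1.2.2.2.1) gb
  -- the `L¹(μ)` and `L¹(ρ)` bounds
  have hdi : ∀ (ρ' : Measure (PointConfig (V3 × V3))) [IsFiniteMeasure ρ'],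
      Integrable (fun x => |ψ (windowRestrict U x) - G x|) ρ' := fun ρ' _ =>
    ((hbi ρ' (hψm.comp hπm) hCπ).sub (hbi ρ' hGm hGC)).abs
  have hsum : ∫ x, |ψ (windowRestrict U x) - G x| ∂μ + ∫ x, |ψ (windowRestrict U x) - G x| ∂ρ ≤ ε := by
    rw [← integral_add_measure (hdi μ) (hdi ρ)]
    simp_rw [hGdef, hgb_eq]
    exact hgε
  have hμε : ∫ x, |ψ (windowRestrict U x) - G x| ∂μ ≤ ε := by
    linarith [integral_nonneg (μ := ρ) (f := fun x => |ψ (windowRestrict U x) - G x|) fun x => abs_nonneg _]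
  have hρε : ∫ x, |ψ (windowRestrict U x) - G x| ∂ρ ≤ ε := by
    linarith [integral_nonneg (μ := μ) (f := fun x => |ψ (windowRestrict U x) - G x|) fun x => abs_nonneg _]
  -- the approximant: `G`, corrected by `ψ - ψ ∘ π` (which vanishes on the range of `π`), clamped to `[-C, C]`
  obtain ⟨ψ', hψ'def⟩ : ∃ ψ' : PointConfig (V3 × V3) → ℝ,
      ∀ ω, ψ' ω = max (-C) (min C (G ω + (ψ ω - ψ (windowRestrict U ω)))) := ⟨_, fun _ => rfl⟩
  have hψ'm : Measurable ψ' := by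
    rw [show ψ' = fun ω => max (-C) (min C (G ω + (ψ ω - ψ (windowRestrict U ω)))) from funext hψ'def]
    exact measurable_const.max (measurable_const.min (hGm.add (hψm.sub (hψm.comp hπm))))
  have hψ'C : ∀ ω, |ψ' ω| ≤ C := fun ω => by
    rw [hψ'def, abs_le]
    exact ⟨le_max_left _ _, max_le (by linarith) (min_le_left _ _)⟩
  have hψ'π : ∀ ω, ψ' (windowRestrict U ω) = G ω := fun ω => by
    have h := abs_le.1 (hGC ω)
    rw [hψ'def, hππ, sub_self, add_zero, hGπ, min_eq_right h.2, max_eq_right h.1]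
  have hpt : ∀ ω, |ψ ω - ψ' ω| ≤ |ψ (windowRestrict U ω) - G ω| := fun ω => by
    have h := abs_le.1 (hC ω)
    rw [hψ'def]
    refine (abs_sub_clamp_le' h.1 h.2).trans_eq ?_
    rw [show ψ ω - (G ω + (ψ ω - ψ (windowRestrict U ω))) = ψ (windowRestrict U ω) - G ω by ring]
  have hwl' : ∀ ρ' : Measure (PointConfig (V3 × V3)), ∫ x, ψ' x ∂(windowLaw U ρ') = ∫ x, G x ∂ρ' := fun ρ' => by
    rw [hwl ρ' hψ'm]
    exact integral_congr_ae (ae_of_all _ hψ'π)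
  refine ⟨ψ', ?_, hψ'm, hψ'C, ?_, ?_⟩
  · -- `ψ' ∈ 𝓥`: its window integrals are the integrals of `G`
    show Tendsto (fun k => ∫ x, ψ' x ∂(windowLaw U (P k))) atTop (𝓝 (∫ x, ψ' x ∂(windowLaw U μ)))
    rw [show (fun k => ∫ x, ψ' x ∂(windowLaw U (P k))) = fun k => ∫ x, G x ∂(P k) from
      funext fun k => hwl' (P k), hwl' μ]
    exact hGt
  · -- the `L¹(windowLaw U μ)` bound
    rw [hwl μ (φ := fun x => |ψ x - ψ' x|) (continuous_abs.measurable.comp (hψm.sub hψ'm))]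
    simp_rw [hψ'π]
    exact hμε
  · -- the `L¹(ρ)` bound
    calc ∫ x, |ψ x - ψ' x| ∂ρ ≤ ∫ x, |ψ (windowRestrict U x) - G x| ∂ρ :=
          integral_mono_of_nonneg (ae_of_all _ fun x => abs_nonneg _) (hdi ρ) (ae_of_all _ hpt)
      _ ≤ ε := hρε

/-! ## The registered stub -/

/-- **WINDOW LOWER SEMICONTINUITY OF THE RELATIVE ENTROPY AGAINST A FIXED REFERENCE ALONG UNIT-WEIGHT TANGENT STATES**
(registered stub `c9_klDiv_windowLaw_tangent_le_liminf` of line `FirstLemma`, crux stmt-AtomisticToContinuum-14135).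
Let `μ` be a unit-weight tangent state of the probability laws `Q k` (carried by the hard-sphere domains) along `ι`,
`U ⊆ ℝ³` an open bounded window and `ρ` a probability law on configurations. Then
`KL(windowLaw U μ ‖ ρ) ≤ liminf_k KL(windowLaw U (blowUpLaw σ 1 (N (ι k)) (Q (ι k))) ‖ ρ)`: the Laplace functionals
of the blown-up laws are the tangent Laplace functionals (`stub_laplaceFunctional_blowUpLaw`), which converge to those
of `μ` (`IsTangentState`), and `klDiv_windowLaw_const_le_liminf_of_laplace` applies (the boundedness of the window is
not needed). -/
theorem c9_klDiv_windowLaw_tangent_le_liminf {σ : ℝ} (hσ : 0 < σ) {N : ℕ → ℕ}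
    {Q : ∀ k, Measure (Config (N k + 1) (Fin 3) T3)} [∀ k, IsProbabilityMeasure (Q k)]
    (hQ : ∀ k, ∀ᵐ z ∂(Q k), z ∈ hardSphereDomain (Literature.Analysis.FluidPDE.Torus.geometry (Fin 3)) (N k + 1)
      (hsDiameter σ (N k)))
    {ι : ℕ → ℕ} {μ : Measure (PointConfig (V3 × V3))} [IsProbabilityMeasure μ]
    (hμ : IsTangentState σ (fun _ => (1 : ℝ)) N Q ι μ) {U : Set V3} (hU : IsOpen U) (hUb : Bornology.IsBounded U)
    (ρ : Measure (PointConfig (V3 × V3))) [IsProbabilityMeasure ρ] :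
    klDiv (windowLaw U μ) ρ ≤
      liminf (fun k => klDiv (windowLaw U (blowUpLaw σ (fun _ => (1 : ℝ)) (N (ι k)) (Q (ι k)))) ρ) atTop := by
  -- the boundedness of the window is not needed on this route
  have _ := hUb
  -- the unit weight: `weightLaw 1` and the blown-up laws are probability laws
  have hint : 0 < ∫ _ : T3, (1 : ℝ) := by
    rw [integral_const, probReal_univ, one_smul]
    exact one_pos
  haveI : IsProbabilityMeasure (weightLaw fun _ : T3 => (1 : ℝ)) :=
    isProbabilityMeasure_weightLaw continuous_const (fun _ => zero_le_one) hint
  haveI : ∀ k, IsProbabilityMeasure (blowUpLaw σ (fun _ => (1 : ℝ)) (N (ι k)) (Q (ι k))) := fun k =>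
    Measure.isProbabilityMeasure_map (measurable_blowUp _ _).aemeasurable
  -- Laplace functionals of the blown-up laws are the tangent Laplace functionals, which converge along `ι`
  refine klDiv_windowLaw_const_le_liminf_of_laplace
    (P := fun k => blowUpLaw σ (fun _ => (1 : ℝ)) (N (ι k)) (Q (ι k))) (fun f hf hfc hf0 => ?_) hU ρ
  exact (hμ.2 f hf hfc hf0).congr fun k =>
    (stub_laplaceFunctional_blowUpLaw hσ continuous_const (fun _ => zero_le_one) hint (Q (ι k)) (hQ (ι k))
      hf hfc hf0).symm

end Summit.AtomisticToContinuum.HydrodynamicLimit.Theorems.KiferCompactification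

end
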